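/-
Copyright: rh-split cell (prover seat l22-w3) gen 0, 2026-08-27.  Pure real analysis (Laplace
transforms of measures with a density); no `Summits` import.
-/
import Literature.Analysis.Asymptotics.KaramataAbelianLaplace
import HarnessLib

/-!
# Exponential growth of the primitive bounds the abscissa of absolute convergence

Widder, *The Laplace Transform* (1941), Ch. II §2, Theorem 2.1: if the determining function
satisfies `α(t) = O(e^{γt})` (`t → ∞`), then `∫₀^∞ e^{-st} dα(t)` converges absolutely for
`Re s > γ`.  We record the density case used by one-sided (Landau-type) doors: `u ≥ 0` measurable
and integrable on every `(0, T]`, with primitive `U(T) = ∫₀ᵀ u ≤ C·e^{βT}` for all `T > 0`; then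
for every `δ > β` with `δ > 0` the Laplace integrand `u(t)e^{-δt}` is integrable on `(0, ∞)` and
`∫₀^∞ u e^{-δt} ≤ Cδ/(δ-β)`-type finiteness holds.  The proof is the tree's Tonelli identity
`KaramataAbelian.lintegral_laplace_eq` (`∫₀^∞ u e^{-δt} = ∫₀^∞ δe^{-δs} U(s) ds`, Feller XIII.5)
followed by the comparison `δe^{-δs}U(s) ≤ δC e^{-(δ-β)s}`.

Deliberately NOT here: the converse direction (Widder Thm 2.2a/b: convergence at `s₀` forces
`α(t) = o(e^{γt})`), signed densities / functions of bounded variation, and the abscissa formula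
(Widder Thm 2.4e).
-/

noncomputable section

namespace Literature.Analysis.Asymptotics

namespace KaramataAbelian

open _root_.MeasureTheory _root_.Set

/-- **Widder II.2, Theorem 2.1 (density case).**  Let `u ≥ 0` on `(0,∞)` be measurable and
integrable on every `(0, T]`, and suppose its primitive grows at most exponentially:
`∫₀ᵀ u ≤ C·e^{βT}` for all `T > 0`, with `C ≥ 0`.  Then for every `δ > 0` with `β < δ` the function
`u(t)·e^{-δt}` is integrable on `(0, ∞)` — the Laplace transform of the measure `u dt` converges
absolutely to the right of the growth exponent of its primitive.
[cite: Widder1941, Ch. II §2, Theorem 2.1] -/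
theorem integrableOn_mul_exp_neg_of_prim_le_exp {u : ℝ → ℝ} (hu : ∀ t, 0 < t → 0 ≤ u t)
    (hmeas : Measurable u) (hint : ∀ T, IntegrableOn u (Ioc 0 T)) {C β : ℝ} (hC : 0 ≤ C)
    (hU : ∀ T, 0 < T → ∫ t in Ioc 0 T, u t ≤ C * Real.exp (β * T)) {δ : ℝ} (hδ : 0 < δ)
    (hβδ : β < δ) :
    IntegrableOn (fun t => u t * Real.exp (-(δ * t))) (Ioi 0) := by
  have hnn : 0 ≤ᵐ[volume.restrict (Ioi 0)] fun t => u t * Real.exp (-(δ * t)) :=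
    ae_restrict_of_forall_mem measurableSet_Ioi fun t ht =>
      mul_nonneg (hu t ht) (Real.exp_pos _).le
  have hm : Measurable fun t => u t * Real.exp (-(δ * t)) :=
    hmeas.mul ((measurable_const.mul measurable_id).neg.exp)
  refine ⟨hm.aestronglyMeasurable, ?_⟩
  rw [hasFiniteIntegral_iff_ofReal hnn, lintegral_laplace_eq hu hmeas hint hδ]
  -- comparison with the integrable majorant `δ C e^{-(δ-β)s}`
  set g : ℝ → ℝ := fun s => δ * C * Real.exp (-(δ - β) * s) with hg
  have hgint : IntegrableOn g (Ioi 0) :=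
    (exp_neg_integrableOn_Ioi 0 (by linarith : 0 < δ - β)).const_mul (δ * C)
  have hgnn : 0 ≤ᵐ[volume.restrict (Ioi 0)] g :=
    ae_of_all _ fun s => mul_nonneg (mul_nonneg hδ.le hC) (Real.exp_pos _).le
  have hfin : ∫⁻ s in Ioi 0, ENNReal.ofReal (g s) < ⊤ :=
    (hasFiniteIntegral_iff_ofReal hgnn).1 hgint.hasFiniteIntegral
  refine lt_of_le_of_lt (setLIntegral_mono' measurableSet_Ioi fun s hs =>
    ENNReal.ofReal_le_ofReal ?_) hfin
  have hs' : 0 < s := hs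
  have hw : 0 ≤ δ * Real.exp (-(δ * s)) := mul_nonneg hδ.le (Real.exp_pos _).le
  calc δ * Real.exp (-(δ * s)) * ∫ t in Ioc 0 s, u t
      ≤ δ * Real.exp (-(δ * s)) * (C * Real.exp (β * s)) :=
        mul_le_mul_of_nonneg_left (hU s hs') hw
    _ = δ * C * (Real.exp (-(δ * s)) * Real.exp (β * s)) := by ring
    _ = g s := by
        rw [hg, ← Real.exp_add]
        congr 1
        ring_nf

/-- The same with the weight written `e^{-δt}` as `Real.exp (-δ * t)` (the form used by the
screw-function Landau doors). [cite: Widder1941, Ch. II §2, Theorem 2.1] -/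
theorem integrableOn_mul_exp_neg_of_prim_le_exp' {u : ℝ → ℝ} (hu : ∀ t, 0 < t → 0 ≤ u t)
    (hmeas : Measurable u) (hint : ∀ T, IntegrableOn u (Ioc 0 T)) {C β : ℝ} (hC : 0 ≤ C)
    (hU : ∀ T, 0 < T → ∫ t in Ioc 0 T, u t ≤ C * Real.exp (β * T)) {δ : ℝ} (hδ : 0 < δ)
    (hβδ : β < δ) :
    IntegrableOn (fun t => u t * Real.exp (-δ * t)) (Ioi 0) := by
  refine (integrableOn_mul_exp_neg_of_prim_le_exp hu hmeas hint hC hU hδ hβδ).congr_fun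
    (fun t _ => ?_) measurableSet_Ioi
  simp only [neg_mul]

/-- **Subexponential primitive ⇒ convergence on the whole open half-line.**  If `u ≥ 0`
(measurable, integrable on every `(0,T]`) has `∫₀ᵀ u ≤ C_ε·e^{εT}` for every `ε > 0`, then
`u(t)e^{-δt}` is integrable on `(0,∞)` for EVERY `δ > 0` (abscissa of absolute convergence `≤ 0`).
[cite: Widder1941, Ch. II §2, Theorem 2.1] -/
theorem integrableOn_mul_exp_neg_of_prim_subexp {u : ℝ → ℝ} (hu : ∀ t, 0 < t → 0 ≤ u t)
    (hmeas : Measurable u) (hint : ∀ T, IntegrableOn u (Ioc 0 T))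
    (hU : ∀ ε : ℝ, 0 < ε → ∃ C : ℝ, 0 ≤ C ∧ ∀ T, 0 < T → ∫ t in Ioc 0 T, u t ≤ C * Real.exp (ε * T))
    {δ : ℝ} (hδ : 0 < δ) :
    IntegrableOn (fun t => u t * Real.exp (-(δ * t))) (Ioi 0) := by
  obtain ⟨C, hC, hCU⟩ := hU (δ / 2) (by positivity)
  exact integrableOn_mul_exp_neg_of_prim_le_exp hu hmeas hint hC hCU hδ (by linarith)

end KaramataAbelian

end Literature.Analysis.Asymptotics

end
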